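import Summits.QuantumFields.BalabanUV.Beta.FP.PeriodisedBorderIndexWard
import Summits.QuantumFields.BalabanUV.Beta.FP.PeriodisedCoarseWardContact
import Summits.QuantumFields.BalabanUV.Beta.FP.TorusGaugeCovariancePairing

/-!
# `BalabanUV.Beta.FP.PeriodisedCompositeIndexWard` — road «FP» for binder row D1, ROUTE T, (T-β-1) AT ORDER 1 FOR THE COMPOSITE AVERAGING `𝔔 = Q₂·Q₁`:
# **THE OWNER g18's LETTER `q1 : Ā₁𝔔₀A₀ + Ā₀𝔔₁A₀ + Ā₀𝔔₀A₁ = 𝔔♯₁` (`NestedStepLawTransported`) AT THE RECORD, FOR DIAGONAL TORUS-GAUGE TRANSPORTS** — with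
# `A₀ = Ā₀ = 1`, `A₁ = −c·E_λ` (fine fields rotate by `λ` at the base of their bond), `Ā₁ = c·R′_λ̄` (coarse-coarse multipliers rotate by the INDUCED `λ̄ = λ∘root` at the root of
# their coarse block), the composite first-order averaging word along a direction `h` IS the composite insertion table along `h + Dλ`:
# `Ā₁·(Q₂₀Q₁₀) + (Q₂^{(h)}Q₁₀ + Q₂₀Q₁^{(h)}) + (Q₂₀Q₁₀)·A₁ = Q₂^{(h+Dλ)}Q₁₀ + Q₂₀Q₁^{(h+Dλ)}` — the level-`j` multiplier rotation `R_λ` CANCELS between the two words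

HONEST DEPENDENCY (page 1, mandatory): continuum YM on T⁴ ⇐ BetaPertH ∧ nine spine estimates (0/9 proved); BetaPertH ⇐ (D1) ∧ (D4) ∧ CAP+tail;
G-an2-4 gates asym, D1 and NE2/3/4.  HONEST FRAMING (cell contract, verbatim): «discharging `BetaPertH` makes Bałaban's UV stability UNCONDITIONAL —
a real constructive-QFT result; it is NOT the continuum limit and NOT the Clay problem.»  ABSOLUTE RULE (cell charter, verbatim): «No internally-minted
statement may enter as a cited fact. Every hypothesis is either kernel-proved in this package or a verbatim quotation of a PUBLISHED theorem with page
reference. The manuscript(s) under audit are NOT citable for their own disputed steps — they are the thing under adjudication; programme-internal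
(2001/route/tribunal) claims are never citable.»  THIS MODULE is [folklore] finite-sum bookkeeping over OUR typed objects BY NAME: `PeriodisedBorderIndexWard` (the
level-`j` `Q₁`-word and its ANY-presentation form one level up), `PeriodisedCoarseWardContact`'s transport weight `θ_j·Q₁₀(a′, ·)`, gan24-leaf-05's MASTER identity
`TorusGaugeCovariancePairing.perF_bhKStepAt_mul_tgrad_sum` (the average of a fine pure gauge is the coarse pure gauge of `λ̄`); no `def`, no `def … : Prop`, nothing cited,
0 sorry; 0 estimates; 0∕4 row-D1 binders; NOT (T-β) complete (the form block `k*`, order 2, the intertwiners `j*`, the dead-row letters are not here; WHETHER the literal's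
transport is this diagonal shadow is the dictionary's ∕ the OWNER's), NOT SDF, NOT D1, NOT BetaPertH, NOT continuum, NOT Clay.  «not in print; our bookkeeping».

WHY (OWNER d1-p3 g18, INTENT I-FP-18-1 `NestedStepLawTransported` — F-FP-18-1 «transport the WHOLE COMPOSITE system»; W-FP-18-4 (i): «your reading level-`j` `Q₁`-word + the
same one level up for `λ̄ = λ∘root` + the `Q₂₁` transport-weight word is exactly how `q1` is meant to be fed — take `FP/PeriodisedCompositeIndexWard` next»).

CONTENT (generic `d`; fine box `fine Lc M′`, coarse box `M′` with `Lc ∣ M′ᵢ`, roots `r r′ ∈ box`; the Delta's `hQ₁₀ hQ₂₀` VERBATIM, ANY coarse-coarse presentation `(pμ′, inr mμ′)`).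
* §1 **`torus_Q10_mul_tgrad_fun`** — `(Q₁₀·Dλ)(p̄, m) = stepScale_j·#B·(Dλ̄)(p̄, m)`, `λ̄ t̄ := Σ_s tdelta F (Lc•t̄ + ρ) s · λ s`.
* §2 `theta_mul` (`θ_j·s_j·#B·(Lc^{d+1}·s_{j+1})⁻¹ = (Lc^{d+1}·s_j)⁻¹`), **`torus_Q21_pureGauge_fun`** — THE `Q₂`-WORD: `Σ_{a′} (θ_j·(Q₁₀Dλ)(a′)) • Q₂₁^{a′} = c • (R′_λ̄·Q₂₀ − Q₂₀·R_λ)`.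
* §3 **`torus_conj_first_composite_word`** — the OWNER's `q1` shape at `A₀ = Ā₀ = 1` (insertion-table families `Q₁₁ w`, `Q₂₁ w` by defining equations, so the statement reads
  for EVERY weight `h` and EVERY `λ`); **`torus_q1_letter`** — the same with the unit jets erased and the composite jets NAMED by the Delta's `h𝔔₀ h𝔔₁`
  (`Xbar * 𝔔₀ + 𝔔₁ + 𝔔₀ * X = 𝔔₁^{(h+Dλ)}` — the `q1` binder TYPE of `NestedStepLawTorusTransported`).
NOT HERE: `q0` (trivial at `A₀ = Ā₀ = 1`: `𝔔♯₀ = 𝔔₀`), `q2`, `k*`, `j*`; the identification of `λ` with the difference of leaf-06's tree-gauge functions (`Π_big` vs `Π_nest`).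
Provenance: D1 formalisation swarm LEAF PROVER 02, unit b2b-balaban-beta-d1-formalise-leaf-02 gen 18, 2026-08-22.  No existing file touched.
-/

noncomputable section

open scoped BigOperators

namespace Summit.QuantumFields.BalabanUV.Beta.FP.PeriodisedCompositeIndexWard

open Finset Matrix
open Literature.Probability.LatticeModels (Torus.proj)
open Literature.MathematicalPhysics.QuantumFieldTheory.Balaban1983to89
open Literature.MathematicalPhysics.QuantumFieldTheory.Balaban1983to89.Beta
open B5Prop11Plancherel (fine)
open B6Lemma24Torus (pbox mem_pbox)
open AffineAveraging (Site box toSite unitVec)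
open AveragingHessianKernelsRooted (vhSAt)
open OneStepResolventKernel (Fib)
open Summit.QuantumFields.BalabanUV.Beta.BorderedHessian (bhKStepAt stepScale stepScale_ne_zero)
open Summit.QuantumFields.BalabanUV.Beta.FP.KernelPeriodisationFib (Idx perF perF_apply)
open Summit.QuantumFields.BalabanUV.Beta.FP.KernelPeriodisationFibLoc (dper)
open Summit.QuantumFields.BalabanUV.Beta.FP.TorusGaugeCovariance (tdelta tdelta_congr tgrad tgrad_inl sum_mul_tgrad_eq_sum_inl)
open Summit.QuantumFields.BalabanUV.Beta.FP.TorusGaugeCovarianceCoarse (coarsePt coarsePt_coe proj_coarsePt)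
open Summit.QuantumFields.BalabanUV.Beta.FP.TorusGaugeCovariancePairing (wrapPt wrapPt_coe wrapPt_of_mem sum_tdelta_mul perF_bhKStepAt_mul_tgrad_sum)
open Summit.QuantumFields.BalabanUV.Beta.FP.PeriodisedBorderIndexWard (torus_Q11_pureGauge_fun torus_pureGauge_fun_of_presentation)

variable {d : ℕ} (M' : Fin (d + 1) → ℕ) [∀ μ, NeZero (M' μ)] {Lc : ℕ} [NeZero Lc] {r r' : Fin (d + 1) → ℕ}

/-! ## §1 The linear average of a torus pure gauge is the COARSE pure gauge of the gauge function read at the block roots -/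

section Average

/-- [folklore] **`(Q₁₀·Dλ)(p̄, m) = stepScale_j · #B · (Dλ̄)(p̄, m)`** with the INDUCED coarse gauge function `λ̄ t̄ := Σ_s tdelta F (Lc•t̄ + ρ) s · λ s` (= `λ` at the box
representative of the root of block `t̄`): the multiplier row `(coarsePt p̄, inr m)` of the torus call's `Q₁₀` (`hQ₁₀` VERBATIM) against the torus gradient of `λ` is the
coarse torus gradient of `λ̄` (gan24-leaf-05's MASTER identity `perF_bhKStepAt_mul_tgrad_sum`, re-read through `tdelta`). -/
theorem torus_Q10_mul_tgrad_fun (hr : r ∈ box (d + 1) Lc) (j : ℕ) (lam : ↥(pbox (fine Lc M')) → ℝ)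
    {Q₁₀ : Matrix (↥(pbox M') × Fin (d + 1)) (↥(pbox (fine Lc M')) × Fin (d + 1)) ℝ}
    (hQ₁₀ : Q₁₀ = (perF (fine Lc M') (bhKStepAt d (toSite r) Lc j)).submatrix
        (fun a : ↥(pbox M') × Fin (d + 1) => ((coarsePt M' Lc a.1, Sum.inr a.2) : Idx (fine Lc M') (Fib d)))
        (fun b : ↥(pbox (fine Lc M')) × Fin (d + 1) => ((b.1, Sum.inl b.2) : Idx (fine Lc M') (Fib d))))
    (a : ↥(pbox M') × Fin (d + 1)) :
    ∑ b : ↥(pbox (fine Lc M')) × Fin (d + 1), Q₁₀ a b * (∑ s : ↥(pbox (fine Lc M')), tgrad (fine Lc M') (b.1, Sum.inl b.2) s * lam s)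
      = stepScale d Lc j * ((box (d + 1) Lc).card : ℝ)
          * ∑ t : ↥(pbox M'), tgrad M' (a.1, Sum.inl a.2) t
              * (∑ s : ↥(pbox (fine Lc M')), tdelta (fine Lc M') ((Lc : ℤ) • (t : Site (d + 1)) + toSite r) s * lam s) := by
  subst hQ₁₀
  -- left: swap the two finite sums, read the field-slot sum as the packed sum, and use the MASTER identity paired with `λ`
  have hL : ∑ b : ↥(pbox (fine Lc M')) × Fin (d + 1),
        (perF (fine Lc M') (bhKStepAt d (toSite r) Lc j)).submatrix
            (fun a : ↥(pbox M') × Fin (d + 1) => ((coarsePt M' Lc a.1, Sum.inr a.2) : Idx (fine Lc M') (Fib d)))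
            (fun b : ↥(pbox (fine Lc M')) × Fin (d + 1) => ((b.1, Sum.inl b.2) : Idx (fine Lc M') (Fib d))) a b
          * (∑ s : ↥(pbox (fine Lc M')), tgrad (fine Lc M') (b.1, Sum.inl b.2) s * lam s)
      = ∑ s : ↥(pbox (fine Lc M')), (∑ q : Idx (fine Lc M') (Fib d),
          perF (fine Lc M') (bhKStepAt d (toSite r) Lc j) (coarsePt M' Lc a.1, Sum.inr a.2) q * tgrad (fine Lc M') q s) * lam s := by
    have e1 : ∀ s : ↥(pbox (fine Lc M')), (∑ q : Idx (fine Lc M') (Fib d),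
          perF (fine Lc M') (bhKStepAt d (toSite r) Lc j) (coarsePt M' Lc a.1, Sum.inr a.2) q * tgrad (fine Lc M') q s)
        = ∑ b : ↥(pbox (fine Lc M')) × Fin (d + 1),
            perF (fine Lc M') (bhKStepAt d (toSite r) Lc j) (coarsePt M' Lc a.1, Sum.inr a.2) (b.1, Sum.inl b.2) * tgrad (fine Lc M') (b.1, Sum.inl b.2) s :=
      fun s => by rw [sum_mul_tgrad_eq_sum_inl, Fintype.sum_prod_type]
    simp only [e1, Matrix.submatrix_apply, Finset.mul_sum, Finset.sum_mul, ← mul_assoc]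
    exact Finset.sum_comm
  rw [hL, perF_bhKStepAt_mul_tgrad_sum (fine Lc M') hr j (coarsePt M' Lc a.1) a.2 lam, if_pos (proj_coarsePt M' Lc a.1)]
  -- right: the coarse gradient of `λ̄` is `λ̄` at the far endpoint minus `λ̄` at the base; re-read the wrapped endpoint mod `F`
  have hR : ∑ t : ↥(pbox M'), tgrad M' (a.1, Sum.inl a.2) t
        * (∑ s : ↥(pbox (fine Lc M')), tdelta (fine Lc M') ((Lc : ℤ) • (t : Site (d + 1)) + toSite r) s * lam s)
      = lam (wrapPt (fine Lc M') ((coarsePt M' Lc a.1 : Site (d + 1)) + toSite r + (Lc : ℤ) • unitVec a.2))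
        - lam (wrapPt (fine Lc M') ((coarsePt M' Lc a.1 : Site (d + 1)) + toSite r)) := by
    simp only [tgrad_inl, sub_mul, Finset.sum_sub_distrib, sum_tdelta_mul]
    rw [wrapPt_of_mem]
    congr 1
    · congr 1
      apply Subtype.ext
      rw [wrapPt_coe, wrapPt_coe]
      apply B6Lemma24Torus.wrap_congr
      intro i
      obtain ⟨k, hk⟩ := B6Lemma24Torus.isPeriod_sub_wrap (M := M') ((a.1 : Site (d + 1)) + unitVec a.2) i
      refine ⟨-k, ?_⟩
      simp only [Pi.sub_apply, Pi.add_apply] at hk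
      simp only [Pi.add_apply, Pi.smul_apply, smul_eq_mul, coarsePt_coe, fine]
      push_cast
      linear_combination (-(Lc : ℤ)) * hk
  rw [hR, mul_assoc]

end Average

/-! ## §2 The chain-rule coarse insertion table along a torus pure gauge is a commutator ONE LEVEL UP (the `Q₂`-word) -/

section CoarseWord

/-- [folklore] the transport scalar: `θ_j · stepScale_j · #B · (Lc^{d+1}·stepScale_{j+1})⁻¹ = (Lc^{d+1}·stepScale_j)⁻¹` (as in `PeriodisedCoarseWardContact`). -/
theorem theta_mul (j : ℕ) :
    stepScale d Lc (j + 1) / (stepScale d Lc j ^ 2 * ((box (d + 1) Lc).card : ℝ)) * (stepScale d Lc j * ((box (d + 1) Lc).card : ℝ))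
        * (((Lc : ℝ) ^ (d + 1) * stepScale d Lc (j + 1))⁻¹)
      = (((Lc : ℝ) ^ (d + 1) * stepScale d Lc j)⁻¹) := by
  have hB : ((box (d + 1) Lc).card : ℝ) ≠ 0 := by
    have hcard : (box (d + 1) Lc).card = Lc ^ (d + 1) := by simp [AffineAveraging.box, Fintype.card_piFinset]
    rw [hcard]; exact_mod_cast pow_ne_zero _ (NeZero.ne Lc)
  have hL : (Lc : ℝ) ^ (d + 1) ≠ 0 := pow_ne_zero _ (by exact_mod_cast NeZero.ne Lc)
  have hs : stepScale d Lc j ≠ 0 := stepScale_ne_zero (d := d) (Lc := Lc) j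
  have hs' : stepScale d Lc (j + 1) ≠ 0 := stepScale_ne_zero (d := d) (Lc := Lc) (j + 1)
  field_simp

/-- [folklore] **THE `Q₂`-WORD**: the chain-rule coarse insertion table (transport weight `θ_j·Q₁₀(a′, ·)`, as in `PeriodisedCoarseWardContact` ∕ `…Rows`) inserted along the
torus pure gauge `Dλ` is the commutator of the level-`(j+1)` averaging rows with the diagonal generators of the INDUCED coarse gauge function `λ̄` (at the fine level:
`R_λ = diagonal (λ̄ p̄)`; one level up: `R′_λ̄ = diagonal (Σ_t̄ tdelta M′ (pμ′ α + ρ′) t̄ · λ̄ t̄)`):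
`Σ_{a′} (θ_j · (Q₁₀·Dλ)(a′)) • Q₂₁^{a′} = c • (R′_λ̄ * Q₂₀ − Q₂₀ * R_λ)`, `c = (Lc^{d+1}·stepScale_j)⁻¹` — §1 + `PeriodisedBorderIndexWard.torus_pureGauge_fun_of_presentation`
on the coarse box (`hQ₁₀`, `hQ₂₀` VERBATIM from the Delta; `Lc ∣ M′ᵢ`, `r r′ ∈ box`). -/
theorem torus_Q21_pureGauge_fun (hr : r ∈ box (d + 1) Lc) (hr' : r' ∈ box (d + 1) Lc) (hM' : ∀ i, Lc ∣ M' i) (j : ℕ)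
    (lam : ↥(pbox (fine Lc M')) → ℝ)
    {κ : Type*} [Fintype κ] [DecidableEq κ] (pμ' : κ → ↥(pbox M')) (mμ' : κ → Fin (d + 1))
    {Q₁₀ : Matrix (↥(pbox M') × Fin (d + 1)) (↥(pbox (fine Lc M')) × Fin (d + 1)) ℝ}
    (hQ₁₀ : Q₁₀ = (perF (fine Lc M') (bhKStepAt d (toSite r) Lc j)).submatrix
        (fun a : ↥(pbox M') × Fin (d + 1) => ((coarsePt M' Lc a.1, Sum.inr a.2) : Idx (fine Lc M') (Fib d)))
        (fun b : ↥(pbox (fine Lc M')) × Fin (d + 1) => ((b.1, Sum.inl b.2) : Idx (fine Lc M') (Fib d))))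
    {Q₂₀ : Matrix κ (↥(pbox M') × Fin (d + 1)) ℝ}
    (hQ₂₀ : Q₂₀ = (perF M' (bhKStepAt d (toSite r') Lc (j + 1))).submatrix (fun a : κ => ((pμ' a, Sum.inr (mμ' a)) : Idx M' (Fib d)))
        (fun b : ↥(pbox M') × Fin (d + 1) => ((b.1, Sum.inl b.2) : Idx M' (Fib d)))) :
    (∑ a' : ↥(pbox M') × Fin (d + 1),
        (stepScale d Lc (j + 1) / (stepScale d Lc j ^ 2 * ((box (d + 1) Lc).card : ℝ))
          * ∑ b : ↥(pbox (fine Lc M')) × Fin (d + 1), Q₁₀ a' b * (∑ s : ↥(pbox (fine Lc M')), tgrad (fine Lc M') (b.1, Sum.inl b.2) s * lam s)) •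
        (perF M' (dper M' (vhSAt (toSite r') d Lc rfl a'.2 (a'.1 : Site (d + 1))))).submatrix (fun a : κ => ((pμ' a, Sum.inr (mμ' a)) : Idx M' (Fib d)))
          (fun b : ↥(pbox M') × Fin (d + 1) => ((b.1, Sum.inl b.2) : Idx M' (Fib d))))
      = (((Lc : ℝ) ^ (d + 1) * stepScale d Lc j)⁻¹) •
          (Matrix.diagonal (fun α : κ => ∑ t : ↥(pbox M'), tdelta M' ((pμ' α : Site (d + 1)) + toSite r') t
              * (∑ s : ↥(pbox (fine Lc M')), tdelta (fine Lc M') ((Lc : ℤ) • (t : Site (d + 1)) + toSite r) s * lam s)) * Q₂₀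
            - Q₂₀ * Matrix.diagonal (fun a : ↥(pbox M') × Fin (d + 1) =>
              ∑ s : ↥(pbox (fine Lc M')), tdelta (fine Lc M') ((Lc : ℤ) • (a.1 : Site (d + 1)) + toSite r) s * lam s)) := by
  -- §1: the averaged gauge is the coarse gradient of `λ̄`, up to `stepScale_j·#B`
  simp only [torus_Q10_mul_tgrad_fun M' hr j lam hQ₁₀, ← mul_assoc]
  simp only [mul_assoc _ (stepScale d Lc j) _, ← smul_smul, ← Finset.smul_sum]
  -- the level-`(j+1)` index-slot word on the coarse box, at the Delta's coarse-coarse presentation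
  have hM'' : ∀ i, M' i = Lc * (M' i / Lc) := fun i => (Nat.mul_div_cancel' (hM' i)).symm
  rw [torus_pureGauge_fun_of_presentation (M := M') (M'' := fun i => M' i / Lc) hM'' hr' (j + 1)
    (fun t : ↥(pbox M') => ∑ s : ↥(pbox (fine Lc M')), tdelta (fine Lc M') ((Lc : ℤ) • (t : Site (d + 1)) + toSite r) s * lam s)
    (fun a : κ => ((pμ' a : ↥(pbox M')) : Site (d + 1))) (fun a => (pμ' a).2) mμ' (Q₀ := Q₂₀) (by rw [hQ₂₀])]
  simp only [smul_smul]
  congr 1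
  rw [← theta_mul (d := d) (Lc := Lc) j]
  ring

end CoarseWord

/-! ## §3 The first-order conjugated COMPOSITE averaging word (`q1` of the OWNER g18's `NestedStepLawTransported`) at diagonal torus-gauge transports -/

section CompositeWord

/-- [folklore] **(T-β-1) AT ORDER 1 FOR THE COMPOSITE AVERAGING `𝔔 = Q₂·Q₁`, IN THE OWNER's WORD SHAPE** (`q1 : Ā₁𝔔₀A₀ + Ā₀𝔔₁A₀ + Ā₀𝔔₀A₁ = 𝔔♯₁` of `NestedStepLawTransported`
with `A₀ = Ā₀ = 1`): for ANY direction `h` on the fine torus bonds and ANY torus gauge function `λ`, with leaf-02's order-1 objects along `h` — `Q₁^{(h)} := Σ_b h b • Q₁₁^{b}`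
(rooted table, p314580's presentation) and the chain-rule coarse insertion `Q₂^{(h)} := Σ_b h b • Σ_{a′} (θ_j·Q₁₀ a′ b) • Q₂₁^{a′}` (`…Rows` ∕ `PeriodisedCoarseWardContact`) — and the
DIAGONAL transport jets `A₁ := −c • E_λ` (fine fields, `λ` at the base of the bond) and `Ā₁ := c • R′_λ̄` (coarse-coarse multipliers, the induced `λ̄` at the root of their
coarse block; `c = (Lc^{d+1}·stepScale_j)⁻¹`):
`Ā₁ * (Q₂₀ * Q₁₀) * 1 + 1 * (Q₂^{(h)} * Q₁₀ + Q₂₀ * Q₁^{(h)}) * 1 + 1 * (Q₂₀ * Q₁₀) * A₁ = Q₂^{(h + Dλ)} * Q₁₀ + Q₂₀ * Q₁^{(h + Dλ)}`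
— the intermediate rotation `R_λ` of the level-`j` multipliers CANCELS between the two words (`hQ₁₀ hQ₂₀` VERBATIM from the Delta; `Lc ∣ M′ᵢ`, `r r′ ∈ box`). -/
theorem torus_conj_first_composite_word (hr : r ∈ box (d + 1) Lc) (hr' : r' ∈ box (d + 1) Lc) (hM' : ∀ i, Lc ∣ M' i) (j : ℕ)
    (h : ↥(pbox (fine Lc M')) × Fin (d + 1) → ℝ) (lam : ↥(pbox (fine Lc M')) → ℝ)
    {κ : Type*} [Fintype κ] [DecidableEq κ] (pμ' : κ → ↥(pbox M')) (mμ' : κ → Fin (d + 1))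
    {Q₁₀ : Matrix (↥(pbox M') × Fin (d + 1)) (↥(pbox (fine Lc M')) × Fin (d + 1)) ℝ}
    (hQ₁₀ : Q₁₀ = (perF (fine Lc M') (bhKStepAt d (toSite r) Lc j)).submatrix
        (fun a : ↥(pbox M') × Fin (d + 1) => ((coarsePt M' Lc a.1, Sum.inr a.2) : Idx (fine Lc M') (Fib d)))
        (fun b : ↥(pbox (fine Lc M')) × Fin (d + 1) => ((b.1, Sum.inl b.2) : Idx (fine Lc M') (Fib d))))
    {Q₂₀ : Matrix κ (↥(pbox M') × Fin (d + 1)) ℝ}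
    (hQ₂₀ : Q₂₀ = (perF M' (bhKStepAt d (toSite r') Lc (j + 1))).submatrix (fun a : κ => ((pμ' a, Sum.inr (mμ' a)) : Idx M' (Fib d)))
        (fun b : ↥(pbox M') × Fin (d + 1) => ((b.1, Sum.inl b.2) : Idx M' (Fib d))))
    -- the two insertion-table families along a weight `w`, by defining equations
    (Q₁₁ : (↥(pbox (fine Lc M')) × Fin (d + 1) → ℝ) → Matrix (↥(pbox M') × Fin (d + 1)) (↥(pbox (fine Lc M')) × Fin (d + 1)) ℝ)
    (hQ₁₁ : ∀ w, Q₁₁ w = ∑ b : ↥(pbox (fine Lc M')) × Fin (d + 1), w b •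
        (perF (fine Lc M') (dper (fine Lc M') (vhSAt (toSite r) d Lc rfl b.2 (b.1 : Site (d + 1))))).submatrix
          (fun a : ↥(pbox M') × Fin (d + 1) => ((coarsePt M' Lc a.1, Sum.inr a.2) : Idx (fine Lc M') (Fib d)))
          (fun b : ↥(pbox (fine Lc M')) × Fin (d + 1) => ((b.1, Sum.inl b.2) : Idx (fine Lc M') (Fib d))))
    (Q₂₁ : (↥(pbox (fine Lc M')) × Fin (d + 1) → ℝ) → Matrix κ (↥(pbox M') × Fin (d + 1)) ℝ)
    (hQ₂₁ : ∀ w, Q₂₁ w = ∑ b : ↥(pbox (fine Lc M')) × Fin (d + 1), w b •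
        ∑ a' : ↥(pbox M') × Fin (d + 1), (stepScale d Lc (j + 1) / (stepScale d Lc j ^ 2 * ((box (d + 1) Lc).card : ℝ)) * Q₁₀ a' b) •
          (perF M' (dper M' (vhSAt (toSite r') d Lc rfl a'.2 (a'.1 : Site (d + 1))))).submatrix (fun a : κ => ((pμ' a, Sum.inr (mμ' a)) : Idx M' (Fib d)))
            (fun b : ↥(pbox M') × Fin (d + 1) => ((b.1, Sum.inl b.2) : Idx M' (Fib d)))) :
    ((((Lc : ℝ) ^ (d + 1) * stepScale d Lc j)⁻¹) •
          Matrix.diagonal (fun α : κ => ∑ t : ↥(pbox M'), tdelta M' ((pμ' α : Site (d + 1)) + toSite r') t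
              * (∑ s : ↥(pbox (fine Lc M')), tdelta (fine Lc M') ((Lc : ℤ) • (t : Site (d + 1)) + toSite r) s * lam s)))
          * (Q₂₀ * Q₁₀) * (1 : Matrix (↥(pbox (fine Lc M')) × Fin (d + 1)) (↥(pbox (fine Lc M')) × Fin (d + 1)) ℝ)
        + (1 : Matrix κ κ ℝ) * (Q₂₁ h * Q₁₀ + Q₂₀ * Q₁₁ h) * (1 : Matrix (↥(pbox (fine Lc M')) × Fin (d + 1)) (↥(pbox (fine Lc M')) × Fin (d + 1)) ℝ)
        + (1 : Matrix κ κ ℝ) * (Q₂₀ * Q₁₀) * (-((((Lc : ℝ) ^ (d + 1) * stepScale d Lc j)⁻¹) •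
            Matrix.diagonal (fun b : ↥(pbox (fine Lc M')) × Fin (d + 1) => lam b.1)))
      = Q₂₁ (fun b => h b + ∑ s : ↥(pbox (fine Lc M')), tgrad (fine Lc M') (b.1, Sum.inl b.2) s * lam s) * Q₁₀
        + Q₂₀ * Q₁₁ (fun b => h b + ∑ s : ↥(pbox (fine Lc M')), tgrad (fine Lc M') (b.1, Sum.inl b.2) s * lam s) := by
  -- the two shifted tables: `Q₂^{(h+Dλ)} = Q₂^{(h)} + c•(R′Q₂₀ − Q₂₀R_λ)`, `Q₁^{(h+Dλ)} = Q₁^{(h)} + c•(R_λQ₁₀ − Q₁₀E_λ)`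
  have h2 : Q₂₁ (fun b => h b + ∑ s : ↥(pbox (fine Lc M')), tgrad (fine Lc M') (b.1, Sum.inl b.2) s * lam s)
      = Q₂₁ h + (((Lc : ℝ) ^ (d + 1) * stepScale d Lc j)⁻¹) •
          (Matrix.diagonal (fun α : κ => ∑ t : ↥(pbox M'), tdelta M' ((pμ' α : Site (d + 1)) + toSite r') t
              * (∑ s : ↥(pbox (fine Lc M')), tdelta (fine Lc M') ((Lc : ℤ) • (t : Site (d + 1)) + toSite r) s * lam s)) * Q₂₀
            - Q₂₀ * Matrix.diagonal (fun a : ↥(pbox M') × Fin (d + 1) =>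
              ∑ s : ↥(pbox (fine Lc M')), tdelta (fine Lc M') ((Lc : ℤ) • (a.1 : Site (d + 1)) + toSite r) s * lam s)) := by
    rw [hQ₂₁, hQ₂₁, ← torus_Q21_pureGauge_fun M' hr hr' hM' j lam pμ' mμ' hQ₁₀ hQ₂₀]
    simp only [add_smul, Finset.sum_add_distrib]
    congr 1
    -- swap the two finite sums and collect the weight `θ·Σ_b Q₁₀ a′ b (Dλ)_b`
    simp only [Finset.smul_sum, smul_smul]
    rw [Finset.sum_comm]
    refine Finset.sum_congr rfl fun a' _ => ?_
    rw [← Finset.sum_smul, Finset.mul_sum]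
    congr 1
    exact Finset.sum_congr rfl fun b _ => by ring
  have h1 : Q₁₁ (fun b => h b + ∑ s : ↥(pbox (fine Lc M')), tgrad (fine Lc M') (b.1, Sum.inl b.2) s * lam s)
      = Q₁₁ h + (((Lc : ℝ) ^ (d + 1) * stepScale d Lc j)⁻¹) •
          (Matrix.diagonal (fun a : ↥(pbox M') × Fin (d + 1) =>
              ∑ s : ↥(pbox (fine Lc M')), tdelta (fine Lc M') ((Lc : ℤ) • (a.1 : Site (d + 1)) + toSite r) s * lam s) * Q₁₀
            - Q₁₀ * Matrix.diagonal (fun b : ↥(pbox (fine Lc M')) × Fin (d + 1) => lam b.1)) := by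
    rw [hQ₁₁, hQ₁₁, ← torus_Q11_pureGauge_fun M' hr j lam hQ₁₀]
    simp only [add_smul, Finset.sum_add_distrib]
  rw [h2, h1, Matrix.mul_one, Matrix.mul_one, Matrix.one_mul, Matrix.one_mul, Matrix.mul_neg, Matrix.mul_smul, Matrix.smul_mul,
    Matrix.add_mul, Matrix.mul_add, Matrix.smul_mul, Matrix.mul_smul, Matrix.sub_mul, Matrix.mul_sub, smul_sub, smul_sub,
    Matrix.mul_assoc, Matrix.mul_assoc, ← Matrix.mul_assoc Q₂₀ (Matrix.diagonal _) Q₁₀]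
  abel

/-- [folklore] **`q1` IN THE LETTER SHAPE OF THE OWNER g18's `NestedStepLawTorusTransported`** (`q1 : Xbar * 𝔔₀ + 𝔔₁ + 𝔔₀ * X = 𝔔'₁`, unit jets erased, the composite jets NAMED by
the Delta's `h𝔔₀ : Q₂₀ * Q₁₀ = 𝔔₀`, `h𝔔₁ : Q₂₁ * Q₁₀ + Q₂₀ * Q₁₁ = 𝔔₁` along the direction `h`): with `X := −(c • E_λ)`, `Xbar := c • R′_λ̄`,
`Xbar * 𝔔₀ + 𝔔₁ + 𝔔₀ * X = 𝔔₁^{(h + Dλ)}` (`:= Q₂^{(h+Dλ)} * Q₁₀ + Q₂₀ * Q₁^{(h+Dλ)}`). -/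
theorem torus_q1_letter (hr : r ∈ box (d + 1) Lc) (hr' : r' ∈ box (d + 1) Lc) (hM' : ∀ i, Lc ∣ M' i) (j : ℕ)
    (h : ↥(pbox (fine Lc M')) × Fin (d + 1) → ℝ) (lam : ↥(pbox (fine Lc M')) → ℝ)
    {κ : Type*} [Fintype κ] [DecidableEq κ] (pμ' : κ → ↥(pbox M')) (mμ' : κ → Fin (d + 1))
    {Q₁₀ : Matrix (↥(pbox M') × Fin (d + 1)) (↥(pbox (fine Lc M')) × Fin (d + 1)) ℝ}
    (hQ₁₀ : Q₁₀ = (perF (fine Lc M') (bhKStepAt d (toSite r) Lc j)).submatrix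
        (fun a : ↥(pbox M') × Fin (d + 1) => ((coarsePt M' Lc a.1, Sum.inr a.2) : Idx (fine Lc M') (Fib d)))
        (fun b : ↥(pbox (fine Lc M')) × Fin (d + 1) => ((b.1, Sum.inl b.2) : Idx (fine Lc M') (Fib d))))
    {Q₂₀ : Matrix κ (↥(pbox M') × Fin (d + 1)) ℝ}
    (hQ₂₀ : Q₂₀ = (perF M' (bhKStepAt d (toSite r') Lc (j + 1))).submatrix (fun a : κ => ((pμ' a, Sum.inr (mμ' a)) : Idx M' (Fib d)))
        (fun b : ↥(pbox M') × Fin (d + 1) => ((b.1, Sum.inl b.2) : Idx M' (Fib d))))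
    (Q₁₁ : (↥(pbox (fine Lc M')) × Fin (d + 1) → ℝ) → Matrix (↥(pbox M') × Fin (d + 1)) (↥(pbox (fine Lc M')) × Fin (d + 1)) ℝ)
    (hQ₁₁ : ∀ w, Q₁₁ w = ∑ b : ↥(pbox (fine Lc M')) × Fin (d + 1), w b •
        (perF (fine Lc M') (dper (fine Lc M') (vhSAt (toSite r) d Lc rfl b.2 (b.1 : Site (d + 1))))).submatrix
          (fun a : ↥(pbox M') × Fin (d + 1) => ((coarsePt M' Lc a.1, Sum.inr a.2) : Idx (fine Lc M') (Fib d)))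
          (fun b : ↥(pbox (fine Lc M')) × Fin (d + 1) => ((b.1, Sum.inl b.2) : Idx (fine Lc M') (Fib d))))
    (Q₂₁ : (↥(pbox (fine Lc M')) × Fin (d + 1) → ℝ) → Matrix κ (↥(pbox M') × Fin (d + 1)) ℝ)
    (hQ₂₁ : ∀ w, Q₂₁ w = ∑ b : ↥(pbox (fine Lc M')) × Fin (d + 1), w b •
        ∑ a' : ↥(pbox M') × Fin (d + 1), (stepScale d Lc (j + 1) / (stepScale d Lc j ^ 2 * ((box (d + 1) Lc).card : ℝ)) * Q₁₀ a' b) •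
          (perF M' (dper M' (vhSAt (toSite r') d Lc rfl a'.2 (a'.1 : Site (d + 1))))).submatrix (fun a : κ => ((pμ' a, Sum.inr (mμ' a)) : Idx M' (Fib d)))
            (fun b : ↥(pbox M') × Fin (d + 1) => ((b.1, Sum.inl b.2) : Idx M' (Fib d))))
    {𝔔₀ 𝔔₁ : Matrix κ (↥(pbox (fine Lc M')) × Fin (d + 1)) ℝ} (h𝔔₀ : Q₂₀ * Q₁₀ = 𝔔₀) (h𝔔₁ : Q₂₁ h * Q₁₀ + Q₂₀ * Q₁₁ h = 𝔔₁) :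
    ((((Lc : ℝ) ^ (d + 1) * stepScale d Lc j)⁻¹) •
          Matrix.diagonal (fun α : κ => ∑ t : ↥(pbox M'), tdelta M' ((pμ' α : Site (d + 1)) + toSite r') t
              * (∑ s : ↥(pbox (fine Lc M')), tdelta (fine Lc M') ((Lc : ℤ) • (t : Site (d + 1)) + toSite r) s * lam s))) * 𝔔₀
        + 𝔔₁
        + 𝔔₀ * (-((((Lc : ℝ) ^ (d + 1) * stepScale d Lc j)⁻¹) • Matrix.diagonal (fun b : ↥(pbox (fine Lc M')) × Fin (d + 1) => lam b.1)))
      = Q₂₁ (fun b => h b + ∑ s : ↥(pbox (fine Lc M')), tgrad (fine Lc M') (b.1, Sum.inl b.2) s * lam s) * Q₁₀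
        + Q₂₀ * Q₁₁ (fun b => h b + ∑ s : ↥(pbox (fine Lc M')), tgrad (fine Lc M') (b.1, Sum.inl b.2) s * lam s) := by
  subst h𝔔₀ h𝔔₁
  have hw := torus_conj_first_composite_word M' hr hr' hM' j h lam pμ' mμ' hQ₁₀ hQ₂₀ Q₁₁ hQ₁₁ Q₂₁ hQ₂₁
  simpa only [Matrix.mul_one, Matrix.one_mul] using hw

end CompositeWord

end Summit.QuantumFields.BalabanUV.Beta.FP.PeriodisedCompositeIndexWard

end
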